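import Summits.ValiantsHypothesis.ValiantsHypothesis.Theorems.KPlusLogSqLawTropicalShiftThreeDefs

/-!
# Route «KPlusLogSqLaw» — SHIFT-THREE-PLUS (the counting-tight `K = 3` family): definitions

HONEST FRAMING.  Definitions-only companion (D-0009) of `…TropicalShiftThreeTight.lean` (seat val-sym-lift-p3 of the
object-search cell `pub-symmetroid`, 2026-08-26; helper chain of the crux `Lifting`, item `stmt-ValiantsHypothesis-19772`,
and a D2/D3 census datum for the crux `TropicalB`, item `…-19771`).  SHIFT-THREE (`…TropicalShiftThreeDefs.lean`) realises
`C(m+2,2) − 1` sign-alternating unique optima at format `(m, 3)` — every class histogram except `(0, 0, m)`, because its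
class-`2` entries are the wrapping ones and a permutation wraps at most `m − 1` times.  SHIFT-THREE-PLUS adds class `2`
on the DIAGONAL with one huge valuation `bigV` (so these entries never compete during the grid phases) and appends the
FINAL TERM `fterm = (1, all class 2)` — the unique term with `m` class-`2` entries, hence the unique optimum for very large
slope — with the sign of its `(0,0)` entry chosen to continue the alternation.  The companion proof file shows that this
gives `C(m+2,2)` optima, i.e. the `K = 3` tropical census row is COUNTING-TIGHT for every `m`
(`T(m,3) = C(m+2,2) − 1`, matching `tropRootLawAt_choose`).  Concrete witnesses only; nothing is asserted about
`TropicalB`, `Lifting`, `KPlusLogSqLaw`, `MatrixDescartes` or `VP ≠ VNP`.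
-/

set_option linter.dupNamespace false
set_option autoImplicit false

namespace Summit.ValiantsHypothesis.ValiantsHypothesis.Theorems.LacunarySymmetroidMatrixDescartes.TropicalCensus

open Summit.ValiantsHypothesis.ValiantsHypothesis.Theorems.MatrixDescartes.Negative

namespace ShiftThree

variable (n : ℕ)

/-- the huge valuation of the diagonal class-`2` entries: `θ_max·D + pen(n) + 1`, `θ_max = θ(n,1)` the last grid slope. -/
def bigV : ℤ := th n n 1 * (bigD n : ℤ) + pen n n + 1

/-- signs of SHIFT-THREE-PLUS: SHIFT-THREE plus class `2` on the diagonal, sign `(−1)^{T m}` at `(0,0)` and `+1` elsewhere. -/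
def eeP : Fin (n + 1) → Fin (n + 1) → Fin 3 → ℤ := fun a b l =>
  if (a : ℕ) = (b : ℕ) ∧ l = 2 then (if (b : ℕ) = 0 then (-1) ^ T n (n + 1) else 1) else ee n a b l

/-- valuations of SHIFT-THREE-PLUS: SHIFT-THREE plus `bigV` on the diagonal class-`2` entries. -/
def vvP : Fin (n + 1) → Fin (n + 1) → Fin 3 → ℤ := fun a b l =>
  if (a : ℕ) = (b : ℕ) ∧ l = 2 then bigV n else vv n a b l

/-- per-entry score of SHIFT-THREE-PLUS after the zero-sum redistribution (same correction as `phi`). -/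
def phiP (θ : ℤ) (a b : Fin (n + 1)) (l : Fin 3) : ℤ :=
  θ * (dd n l : ℤ) - vvP n a b l + θ * (2 * n + 5) * shiftZ n a b -
    θ * (bigD n : ℤ) * (if (a : ℕ) < (b : ℕ) then 1 else 0)

/-- the final term: identity permutation, every column of class `2` (histogram `(0, 0, m)`). -/
def fterm : Equiv.Perm (Fin (n + 1)) × (Fin (n + 1) → Fin 3) := (1, fun _ => 2)

/-- the extended chain of slopes: the grid slopes, then `bigV`. -/
def thP (k : ℕ) : ℤ := if k < T n (n + 1) then th n (grid n k).1 (grid n k).2 else bigV n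

/-- the extended chain of terms: the grid terms, then the final term. -/
def ctermP (k : ℕ) : Equiv.Perm (Fin (n + 1)) × (Fin (n + 1) → Fin 3) :=
  if k < T n (n + 1) then cterm n (grid n k).1 (grid n k).2 else fterm n

end ShiftThree

end Summit.ValiantsHypothesis.ValiantsHypothesis.Theorems.LacunarySymmetroidMatrixDescartes.TropicalCensus
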